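import Literature.Algebra.InverseSystem.AddInverseLimit
import Mathlib.Topology.Compactness.Compact
import Mathlib.Topology.Constructions
import HarnessLib

/-!
# Exactness of sequential inverse limits: Mittag-Leffler for towers of finite groups, and lifting
# compatible families along tower maps with finite (or Mittag-Leffler) kernels

Elementary algebra for the passage from levelwise ("finite-coefficient", "finite-layer") exact
sequences to exact sequences of `ℕ`-indexed inverse limits (Atiyah–Macdonald, Prop. 10.2; Weibel,
§3.5: the Mittag-Leffler condition, Prop. 3.5.7), for the concrete inverse limit
`Literature.Algebra.InverseSystem.addInverseLimit t ≤ Π m, G m` of the sibling file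
`AddInverseLimit.lean` (subgroup of compatible families; API `proj`, `lift`, `map`, `congr`).

For towers `A = (A m, tA m : A (m+1) →+ A m)`, `B`, `C` and tower maps `f : A → B`, `g : B → C`
(levelwise homomorphisms commuting with the transitions) we prove:

* `exists_sub_transition_eq_of_finite` — **Mittag-Leffler, finite case, surjectivity form**: if every
  `K m` is finite then `(k_m) ↦ (k_m - t_m k_{m+1})` is onto `Π m, K m` (i.e. `lim¹ K = 0`), by
  compactness of `Π m, K m` (each finite stage is solvable downwards); and
  `exists_sub_transition_eq_of_surjective` — the same when every transition map is onto (solve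
  upwards by dependent choice).
* `addInverseLimit.exists_map_eq_of_forall_mem_range_of_finite_ker` — **the lifting lemma**: if every
  kernel `ker (f m)` is finite, a compatible family `x ∈ lim B` all of whose components are values,
  `x m ∈ range (f m)`, is the image of a compatible family: `x = lim f (a)` for some `a ∈ lim A`
  (choose preimages levelwise; their failure to be compatible is a family in the kernel tower, which
  is a `lim¹`-coboundary by Mittag-Leffler; correct by it). Variant `…_of_ker_transition_surjective`.
* Consequences (Atiyah–Macdonald Prop. 10.2 for towers whose kernel system is finite / surjective):
  `addInverseLimit.map_surjective_of_surjective_of_finite_ker` (levelwise onto with finite kernels ⟹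
  onto on limits), `addInverseLimit.ker_map_le_range_map_of_finite_ker` (levelwise `ker g ≤ range f`
  with finite `ker f` ⟹ `ker (lim g) ≤ range (lim f)`), their surjective-kernel-transition variants,
  and the unconditional halves `addInverseLimit.map_injective` (levelwise injective ⟹ injective),
  `addInverseLimit.mem_ker_map_iff`, `addInverseLimit.range_map_le_ker_map` (levelwise `g ∘ f = 0` ⟹
  `lim g ∘ lim f = 0`), `addInverseLimit.ker_map_eq_range_map_of_finite_ker` (levelwise exact with
  finite `ker f` ⟹ exact on limits).

All statements are proved; there are no named facts in this file.

## Why (where this is used)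

Iwasawa-theoretic "`Λ`-adic" objects of the tree are inverse limits of finite-level Galois-cohomology
groups along corestriction / multiplication-by-`p` maps (e.g. the compact Selmer carriers
`WeierstrassCurve.LambdaAdicSelmerData.S = lim←_n S_p(E/K_n)`, `AcSigned.lambdaAdic`,
`Kato2004.IwasawaH1Data`), and the printed sources pass finite-level exact sequences (Poitou–Tate for
Selmer structures, Cassels–Poitou–Tate, local Tate duality) to the limit by exactly the mechanism
proved here: "the groups are finite, so the Mittag-Leffler condition holds and `lim←` is exact"
(e.g. Castella–Wan 2024, (6.12)–(6.13); Kobayashi 2003, Thm. 7.3; Perrin-Riou, §1.3.3). This file is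
the carrier-free algebra of that step; it asserts nothing about any arithmetic object.

## Design notes

* Towers are EXPLICIT DATA `(K : ℕ → Type*) [∀ m, AddCommGroup (K m)] (t : ∀ m, K (m+1) →+ K m)`, as in
  `AddInverseLimit.lean` and `Literature.Algebra.Homology.InverseSystemExtensions`; `lim¹` is never
  formed — its vanishing is stated as the solvability of `k_m - t_m k_{m+1} = d_m` (the cokernel of
  Atiyah–Macdonald's `d^K`), which is what the lifting lemma consumes.
* The compactness proof of the finite Mittag-Leffler lemma is adapted from
  `Literature.AlgebraicGeometry.Motives.towerDiff_surjective_of_finite` (`EllAdicComparison.lean`, same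
  statement for the `towerLim`/`TowerLimOne` presentation used by the `ℓ`-adic files); that file is not
  imported here to keep this algebra file free of the étale-cohomology dependencies, and the two
  `lim` presentations agree by `Literature.AlgebraicGeometry.Motives.towerLim_eq_addInverseLimit`.
* Kernel towers are handled through families `d : ∀ m, A m` with `∀ m, f m (d m) = 0` and the
  subtype tower `fun m ↦ (f m).ker` only inside proofs, so that statements mention no auxiliary
  definition.

References: [AtiyahMacdonald1969] Ch. 10, Prop. 10.2 (and the map `d^A` of its proof);
[Weibel1994] §3.5, Def. 3.5.6 (Mittag-Leffler), Prop. 3.5.7, Ex. 3.5.2.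
-/

namespace Literature.Algebra.InverseSystem

universe u v w

open Function

/-! ### Mittag-Leffler: solvability of `k_m - t_m k_{m+1} = d_m` -/

section MittagLeffler

variable {K : ℕ → Type u} [∀ m, AddCommGroup (K m)]

/-- Finite stages of the equation `k_m - t_m k_{m+1} = d_m` are always solvable: for every `N` there
is `k` with `k_m - t_m k_{m+1} = d_m` for all `m < N` (solve downwards from `k_N := 0`; induction on
`N` over the shifted tower). Adapted from `Literature.AlgebraicGeometry.Motives.exists_towerDiff_apply_eq_of_lt`.
[cite: AtiyahMacdonald1969, Ch. 10, proof of Prop. 10.2 (the map `d^A`)] -/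
theorem exists_sub_transition_eq_of_lt (N : ℕ) :
    ∀ {K : ℕ → Type u} [∀ m, AddCommGroup (K m)] (t : ∀ m, K (m + 1) →+ K m) (d : ∀ m, K m),
      ∃ k : ∀ m, K m, ∀ m < N, k m - t m (k (m + 1)) = d m := by
  induction N with
  | zero => exact fun _ _ ↦ ⟨0, fun m hm ↦ absurd hm (Nat.not_lt_zero m)⟩
  | succ N ih =>
    intro K _ t d
    obtain ⟨k', hk'⟩ := ih (fun m ↦ t (m + 1)) (fun m ↦ d (m + 1))
    refine ⟨fun m ↦ match m with
      | 0 => d 0 + t 0 (k' 0)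
      | m + 1 => k' m, ?_⟩
    intro m hm
    match m with
    | 0 => exact add_sub_cancel_right _ _
    | m + 1 => exact hk' m (by omega)

/-- **Mittag-Leffler for a tower of finite abelian groups, surjectivity form** (`lim¹ K = 0`): if
every `K m` is finite, then for every family `d` there is a family `k` with `k_m - t_m k_{m+1} = d_m`
for all `m`. Proof: the sets `C_N = {k | k_m - t_m k_{m+1} = d_m for m < N}` are non-empty
(`exists_sub_transition_eq_of_lt`), closed and decreasing in the compact space `Π_m K m` (product of
finite discrete spaces), so their intersection is non-empty. Adapted from
`Literature.AlgebraicGeometry.Motives.towerDiff_surjective_of_finite`.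
[cite: Weibel1994, §3.5 Def. 3.5.6, Prop. 3.5.7 (finite groups satisfy the Mittag-Leffler condition trivially)]
[cite: AtiyahMacdonald1969, Ch. 10, proof of Prop. 10.2] -/
theorem exists_sub_transition_eq_of_finite [∀ m, Finite (K m)] (t : ∀ m, K (m + 1) →+ K m)
    (d : ∀ m, K m) : ∃ k : ∀ m, K m, ∀ m, k m - t m (k (m + 1)) = d m := by
  letI : ∀ m, TopologicalSpace (K m) := fun _ ↦ ⊥
  haveI : ∀ m, DiscreteTopology (K m) := fun _ ↦ ⟨rfl⟩
  let C : ℕ → Set (∀ m, K m) := fun N ↦ {k | ∀ m < N, k m - t m (k (m + 1)) = d m}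
  have hC : ∀ N, IsClosed (C N) := by
    intro N
    have : C N = ⋂ (m : ℕ) (_ : m < N), {k | k m - t m (k (m + 1)) = d m} := by
      ext k; simp [C]
    rw [this]
    refine isClosed_iInter fun m ↦ isClosed_iInter fun _ ↦ ?_
    refine isClosed_eq ?_ continuous_const
    exact (continuous_of_discreteTopology (f := fun q : K m × K (m + 1) ↦ q.1 - t m q.2)).comp
      ((continuous_apply m).prodMk (continuous_apply (m + 1)))
  have hC' : ∀ N, C (N + 1) ⊆ C N := fun N k hk m hm ↦ hk m (by omega)
  have hCne : ∀ N, (C N).Nonempty := fun N ↦ exists_sub_transition_eq_of_lt N t d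
  obtain ⟨k, hk⟩ := IsCompact.nonempty_iInter_of_sequence_nonempty_isCompact_isClosed C hC' hCne
    (hC 0).isCompact hC
  exact ⟨k, fun m ↦ (Set.mem_iInter.1 hk (m + 1)) m (Nat.lt_succ_self m)⟩

/-- **Mittag-Leffler for a tower with surjective transition maps, surjectivity form** (`lim¹ K = 0`):
if every `t m` is onto, then for every family `d` there is `k` with `k_m - t_m k_{m+1} = d_m` for all
`m` (dependent choice upwards). [cite: AtiyahMacdonald1969, Ch. 10, Prop. 10.2 ("if moreover `{A_n}` is a surjective system … `d^A` is surjective")]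
[cite: Weibel1994, §3.5 Lemma 3.5.3] -/
theorem exists_sub_transition_eq_of_surjective (t : ∀ m, K (m + 1) →+ K m)
    (ht : ∀ m, Surjective (t m)) (d : ∀ m, K m) :
    ∃ k : ∀ m, K m, ∀ m, k m - t m (k (m + 1)) = d m := by
  -- `k_0 := 0`, `k_{m+1}` := a chosen preimage of `k_m - d_m` under `t_m`
  let k : ∀ m, K m := fun m ↦
    Nat.rec (motive := fun m ↦ K m) 0 (fun m km ↦ Classical.choose (ht m (km - d m))) m
  have hk : ∀ m, t m (k (m + 1)) = k m - d m := fun m ↦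
    Classical.choose_spec (ht m (k m - d m))
  exact ⟨k, fun m ↦ by rw [hk, sub_sub_cancel]⟩

end MittagLeffler

/-! ### Tower maps: the unconditional halves -/

namespace addInverseLimit

section Maps

variable {A : ℕ → Type u} {B : ℕ → Type v} {C : ℕ → Type w} [∀ m, AddCommGroup (A m)]
  [∀ m, AddCommGroup (B m)] [∀ m, AddCommGroup (C m)] {tA : ∀ m, A (m + 1) →+ A m}
  {tB : ∀ m, B (m + 1) →+ B m} {tC : ∀ m, C (m + 1) →+ C m}
  {f : ∀ m, A m →+ B m} {hf : ∀ m x, tB m (f (m + 1) x) = f m (tA m x)}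
  {g : ∀ m, B m →+ C m} {hg : ∀ m x, tC m (g (m + 1) x) = g m (tB m x)}

/-- Components of the induced map on limits (coercion form of `proj_map`): the map of inverse systems
induced on `lim←` acts componentwise. [cite: AtiyahMacdonald1969, Ch. 10, p. 104 (a homomorphism of inverse systems induces `lim A_n → lim B_n`)] -/
theorem coe_map_apply (a : addInverseLimit tA) (m : ℕ) :
    (map tA tB f hf a : ∀ m, B m) m = f m ((a : ∀ m, A m) m) := rfl

/-- A compatible family is in the kernel of the induced map iff all its components are in the
levelwise kernels (`lim` commutes with kernels). [cite: AtiyahMacdonald1969, Ch. 10, Prop. 10.2 (left exactness of `lim←`)] -/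
theorem mem_ker_map_iff (x : addInverseLimit tA) :
    x ∈ (map tA tB f hf).ker ↔ ∀ m, f m ((x : ∀ m, A m) m) = 0 := by
  rw [AddMonoidHom.mem_ker]
  refine ⟨fun h m ↦ ?_, fun h ↦ ext fun m ↦ ?_⟩
  · have := congrArg (fun y : addInverseLimit tB ↦ (y : ∀ m, B m) m) h
    simpa [coe_map_apply] using this
  · rw [proj_map, proj_apply, h m]; rfl

/-- **Levelwise injective ⟹ injective on limits** (`lim←` is left exact).
[cite: AtiyahMacdonald1969, Ch. 10, Prop. 10.2 ("`0 → lim A_n → lim B_n → lim C_n` is always exact")] -/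
theorem map_injective (hinj : ∀ m, Injective (f m)) : Injective (map tA tB f hf) := by
  intro x y h
  refine ext fun m ↦ hinj m ?_
  have := congrArg (fun z : addInverseLimit tB ↦ (z : ∀ m, B m) m) h
  rw [proj_apply, proj_apply]
  exact this

/-- Levelwise `g ∘ f = 0` ⟹ `lim g ∘ lim f = 0`: the image of the induced map lies in the kernel
of the next one. [cite: AtiyahMacdonald1969, Ch. 10, Prop. 10.2] -/
theorem range_map_le_ker_map (hgf : ∀ m x, g m (f m x) = 0) :
    (map tA tB f hf).range ≤ (map tB tC g hg).ker := by
  rintro _ ⟨a, rfl⟩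
  rw [mem_ker_map_iff]
  intro m
  rw [coe_map_apply, hgf]

/-- A compatible family all of whose components lie in the levelwise kernels `ker (g m)` has, when
`ker (g m) ≤ range (f m)` levelwise, all its components in the levelwise images (the levelwise
exactness hypothesis of Atiyah–Macdonald's Prop. 10.2, read on one compatible family; bookkeeping for
the lifting lemma). [cite: AtiyahMacdonald1969, Ch. 10, Prop. 10.2 (exact sequence of inverse systems)] -/
theorem forall_mem_range_of_mem_ker (hexact : ∀ m, (g m).ker ≤ (f m).range)
    {x : addInverseLimit tB} (hx : x ∈ (map tB tC g hg).ker) (m : ℕ) :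
    (x : ∀ m, B m) m ∈ (f m).range :=
  hexact m ((mem_ker_map_iff x).1 hx m)

end Maps

/-! ### The lifting lemma and the exactness of `lim←` under Mittag-Leffler kernels -/

section Lifting

variable {A : ℕ → Type u} {B : ℕ → Type v} {C : ℕ → Type w} [∀ m, AddCommGroup (A m)]
  [∀ m, AddCommGroup (B m)] [∀ m, AddCommGroup (C m)] {tA : ∀ m, A (m + 1) →+ A m}
  {tB : ∀ m, B (m + 1) →+ B m} {tC : ∀ m, C (m + 1) →+ C m}
  {f : ∀ m, A m →+ B m} {hf : ∀ m x, tB m (f (m + 1) x) = f m (tA m x)}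
  {g : ∀ m, B m →+ C m} {hg : ∀ m x, tC m (g (m + 1) x) = g m (tB m x)}

/-- The transition maps of `A` restrict to the KERNEL TOWER of a tower map `f : A → B`
(`tA` carries `ker f_{m+1}` into `ker f_m`, since `f_m ∘ tA_m = tB_m ∘ f_{m+1}`): the kernel of a
homomorphism of inverse systems is an inverse system. [cite: AtiyahMacdonald1969, Ch. 10, Prop. 10.2 and p. 104 (kernels of maps of inverse systems)] -/
theorem transition_mem_ker (hf : ∀ m x, tB m (f (m + 1) x) = f m (tA m x)) (m : ℕ)
    {x : A (m + 1)} (hx : x ∈ (f (m + 1)).ker) : tA m x ∈ (f m).ker := by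
  rw [AddMonoidHom.mem_ker] at hx ⊢
  rw [← hf, hx, map_zero]

/-- **The lifting lemma, abstract Mittag-Leffler form.** Suppose the kernel tower of `f` has
`lim¹ = 0` in the concrete sense that every family `d` with `f_m d_m = 0` is of the form
`d_m = k_m - tA_m k_{m+1}` with `f_m k_m = 0`. Then every compatible family `x ∈ lim B` with
`x_m ∈ range f_m` for all `m` lifts: `x = lim f (a)` for some `a ∈ lim A`. Proof: choose preimages
`a_m ↦ x_m`; then `d_m = a_m - tA_m a_{m+1}` lies in `ker f_m` (both terms map to `x_m` by
compatibility of `x`); write `d = k - tA k` in the kernel tower and take `a - k`.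
[cite: AtiyahMacdonald1969, Ch. 10, Prop. 10.2 and its proof (snake lemma with `coker d^A = lim¹`)]
[cite: Weibel1994, §3.5 Prop. 3.5.7] -/
theorem exists_map_eq_of_forall_mem_range_of_ker_limOne
    (hML : ∀ d : ∀ m, A m, (∀ m, f m (d m) = 0) →
      ∃ k : ∀ m, A m, (∀ m, f m (k m) = 0) ∧ ∀ m, k m - tA m (k (m + 1)) = d m)
    (x : addInverseLimit tB) (hx : ∀ m, (x : ∀ m, B m) m ∈ (f m).range) :
    ∃ a : addInverseLimit tA, map tA tB f hf a = x := by
  choose a ha using hx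
  -- the defect of compatibility of the chosen preimages lies in the kernel tower
  have hd : ∀ m, f m (a m - tA m (a (m + 1))) = 0 := fun m ↦ by
    rw [map_sub, ← hf, ha, ha, sub_eq_zero]
    exact (x.2 m).symm
  obtain ⟨k, hk0, hk⟩ := hML (fun m ↦ a m - tA m (a (m + 1))) hd
  refine ⟨⟨fun m ↦ a m - k m, fun m ↦ ?_⟩, ext fun m ↦ ?_⟩
  · -- compatibility of `a - k`
    have h := hk m
    rw [map_sub]
    -- from `k m - tA (k (m+1)) = a m - tA (a (m+1))`
    have : tA m (a (m + 1)) - tA m (k (m + 1)) = a m - k m := by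
      rw [sub_eq_sub_iff_add_eq_add] at h ⊢
      rw [add_comm (tA m (a (m + 1))), ← h, add_comm]
    exact this
  · rw [proj_map, proj_apply]
    change f m (a m - k m) = (x : ∀ m, B m) m
    rw [map_sub, hk0 m, sub_zero, ha]

/-- **The lifting lemma, finite kernels**: if every `ker f_m` is FINITE, every compatible family
`x ∈ lim B` with `x_m ∈ range f_m` for all `m` is `lim f (a)` for some compatible `a ∈ lim A`
(Mittag-Leffler for the finite kernel tower, `exists_sub_transition_eq_of_finite`, then
`exists_map_eq_of_forall_mem_range_of_ker_limOne`).
[cite: Weibel1994, §3.5 Prop. 3.5.7 with Def. 3.5.6 (towers of finite groups are Mittag-Leffler)]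
[cite: AtiyahMacdonald1969, Ch. 10, Prop. 10.2] -/
theorem exists_map_eq_of_forall_mem_range_of_finite_ker (hfin : ∀ m, Finite (f m).ker)
    (x : addInverseLimit tB) (hx : ∀ m, (x : ∀ m, B m) m ∈ (f m).range) :
    ∃ a : addInverseLimit tA, map tA tB f hf a = x := by
  refine exists_map_eq_of_forall_mem_range_of_ker_limOne (fun d hd ↦ ?_) x hx
  -- the kernel tower `ker f_{m+1} →+ ker f_m` (restriction of `tA m`, `transition_mem_ker`)
  obtain ⟨k, hk⟩ := exists_sub_transition_eq_of_finite (K := fun m ↦ (f m).ker)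
    (fun m ↦ ((tA m).comp (f (m + 1)).ker.subtype).codRestrict (f m).ker
      fun y ↦ transition_mem_ker hf m y.2)
    (fun m ↦ ⟨d m, hd m⟩)
  refine ⟨fun m ↦ (k m : A m), fun m ↦ (k m).2, fun m ↦ ?_⟩
  have := congrArg (fun y : (f m).ker ↦ (y : A m)) (hk m)
  simpa [AddSubgroup.coe_sub] using this

/-- **The lifting lemma, surjective kernel transitions**: if the transition maps of `A` are onto
between the kernels (`tA_m : ker f_{m+1} → ker f_m` surjective — e.g. `ker f` a surjective system),
every compatible family with components in the images lifts to a compatible family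
(`exists_sub_transition_eq_of_surjective`, then `exists_map_eq_of_forall_mem_range_of_ker_limOne`).
[cite: AtiyahMacdonald1969, Ch. 10, Prop. 10.2 (surjective system case)] -/
theorem exists_map_eq_of_forall_mem_range_of_ker_transition_surjective
    (hsurj : ∀ m, ∀ y ∈ (f m).ker, ∃ x ∈ (f (m + 1)).ker, tA m x = y)
    (x : addInverseLimit tB) (hx : ∀ m, (x : ∀ m, B m) m ∈ (f m).range) :
    ∃ a : addInverseLimit tA, map tA tB f hf a = x := by
  refine exists_map_eq_of_forall_mem_range_of_ker_limOne (fun d hd ↦ ?_) x hx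
  -- the kernel tower `ker f_{m+1} →+ ker f_m` (restriction of `tA m`) has surjective transitions
  let tK : ∀ m, (f (m + 1)).ker →+ (f m).ker := fun m ↦
    ((tA m).comp (f (m + 1)).ker.subtype).codRestrict (f m).ker fun y ↦ transition_mem_ker hf m y.2
  have ht : ∀ m, Surjective (tK m) := fun m y ↦ by
    obtain ⟨x, hx, hxy⟩ := hsurj m y y.2
    exact ⟨⟨x, hx⟩, Subtype.ext hxy⟩
  obtain ⟨k, hk⟩ := exists_sub_transition_eq_of_surjective (K := fun m ↦ (f m).ker) tK ht
    (fun m ↦ ⟨d m, hd m⟩)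
  refine ⟨fun m ↦ (k m : A m), fun m ↦ (k m).2, fun m ↦ ?_⟩
  have := congrArg (fun y : (f m).ker ↦ (y : A m)) (hk m)
  simpa [AddSubgroup.coe_sub, tK] using this

/-- **Levelwise onto with finite kernels ⟹ onto on limits** (Mittag-Leffler: `lim¹ (ker g) = 0`, so
`lim B → lim C → lim¹ (ker g)` forces surjectivity). The case of finite groups `B m` is included.
[cite: AtiyahMacdonald1969, Ch. 10, Prop. 10.2] [cite: Weibel1994, §3.5 Prop. 3.5.7] -/
theorem map_surjective_of_surjective_of_finite_ker (hsurj : ∀ m, Surjective (g m))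
    (hfin : ∀ m, Finite (g m).ker) : Surjective (map tB tC g hg) := fun x ↦
  exists_map_eq_of_forall_mem_range_of_finite_ker hfin x fun m ↦ hsurj m _

/-- **Levelwise onto with a surjective kernel system ⟹ onto on limits** (Atiyah–Macdonald Prop. 10.2,
second sentence: "if `{A_n}` is a surjective system then `0 → lim A_n → lim B_n → lim C_n → 0` is
exact", applied with `A = ker g`). [cite: AtiyahMacdonald1969, Ch. 10, Prop. 10.2] -/
theorem map_surjective_of_surjective_of_ker_transition_surjective (hsurj : ∀ m, Surjective (g m))
    (hker : ∀ m, ∀ y ∈ (g m).ker, ∃ x ∈ (g (m + 1)).ker, tB m x = y) :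
    Surjective (map tB tC g hg) := fun x ↦
  exists_map_eq_of_forall_mem_range_of_ker_transition_surjective hker x fun m ↦ hsurj m _

/-- **Middle exactness on limits from levelwise exactness, finite kernels**: if `ker g_m ≤ range f_m`
for every `m` and every `ker f_m` is finite, then `ker (lim g) ≤ range (lim f)`. (With
`range_map_le_ker_map` this is the exactness of `lim A → lim B → lim C`.) The typical use: an exact
sequence of FINITE groups at every level of a tower — e.g. Poitou–Tate or Cassels–Tate sequences with
finite coefficients — stays exact after `lim←`.
[cite: Weibel1994, §3.5 Prop. 3.5.7 (Mittag-Leffler ⟹ `lim¹ = 0` ⟹ `lim←` exact)]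
[cite: AtiyahMacdonald1969, Ch. 10, Prop. 10.2] -/
theorem ker_map_le_range_map_of_finite_ker (hexact : ∀ m, (g m).ker ≤ (f m).range)
    (hfin : ∀ m, Finite (f m).ker) : (map tB tC g hg).ker ≤ (map tA tB f hf).range := by
  intro x hx
  obtain ⟨a, ha⟩ := exists_map_eq_of_forall_mem_range_of_finite_ker (hf := hf) hfin x
    (forall_mem_range_of_mem_ker hexact hx)
  exact ⟨a, ha⟩

/-- Middle exactness on limits from levelwise exactness when the kernel system of `f` has surjective
transitions. [cite: AtiyahMacdonald1969, Ch. 10, Prop. 10.2] -/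
theorem ker_map_le_range_map_of_ker_transition_surjective (hexact : ∀ m, (g m).ker ≤ (f m).range)
    (hker : ∀ m, ∀ y ∈ (f m).ker, ∃ x ∈ (f (m + 1)).ker, tA m x = y) :
    (map tB tC g hg).ker ≤ (map tA tB f hf).range := by
  intro x hx
  obtain ⟨a, ha⟩ := exists_map_eq_of_forall_mem_range_of_ker_transition_surjective (hf := hf) hker x
    (forall_mem_range_of_mem_ker hexact hx)
  exact ⟨a, ha⟩

/-- **`lim←` of a levelwise exact sequence with finite kernels is exact**: if `range f_m = ker g_m`
for all `m` and every `ker f_m` is finite, then `range (lim f) = ker (lim g)`. In particular a tower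
of exact sequences `A_m → B_m → C_m` of FINITE abelian groups has exact limit `lim A → lim B → lim C`.
[cite: AtiyahMacdonald1969, Ch. 10, Prop. 10.2] [cite: Weibel1994, §3.5 Prop. 3.5.7] -/
theorem ker_map_eq_range_map_of_finite_ker (hexact : ∀ m, (f m).range = (g m).ker)
    (hfin : ∀ m, Finite (f m).ker) : (map tB tC g hg).ker = (map tA tB f hf).range :=
  le_antisymm (ker_map_le_range_map_of_finite_ker (fun m ↦ (hexact m).ge) hfin)
    (range_map_le_ker_map fun m x ↦ by
      have : f m x ∈ (g m).ker := (hexact m).le ⟨x, rfl⟩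
      exact this)

/-- **Short exact towers with finite kernels have short exact limits**: if at every level
`0 → A_m → B_m → C_m → 0` is exact (`f_m` injective, `range f_m = ker g_m`, `g_m` onto) and every
`A_m` is finite, then `lim f` is injective, `range (lim f) = ker (lim g)` and `lim g` is onto.
[cite: AtiyahMacdonald1969, Ch. 10, Prop. 10.2] -/
theorem shortExact_map_of_finite (hinj : ∀ m, Injective (f m))
    (hexact : ∀ m, (f m).range = (g m).ker) (hsurj : ∀ m, Surjective (g m))
    (hfin : ∀ m, Finite (A m)) :
    Injective (map tA tB f hf) ∧ (map tB tC g hg).ker = (map tA tB f hf).range ∧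
      Surjective (map tB tC g hg) := by
  refine ⟨map_injective hinj, ker_map_eq_range_map_of_finite_ker hexact (fun m ↦ ?_),
    map_surjective_of_surjective_of_finite_ker hsurj fun m ↦ ?_⟩
  · exact Finite.of_injective (fun y : (f m).ker ↦ (y : A m)) Subtype.val_injective
  · -- `ker g_m = range f_m` is the image of the finite group `A_m`
    haveI := hfin m
    rw [← hexact m]
    exact Finite.of_surjective (fun a : A m ↦ (⟨f m a, ⟨a, rfl⟩⟩ : (f m).range))
      fun y ↦ by obtain ⟨a, ha⟩ := y.2; exact ⟨a, Subtype.ext ha⟩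

end Lifting

end addInverseLimit

end Literature.Algebra.InverseSystem
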